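import Summits.CriticalPhenomena.PercolationContinuityZ3.Theorems.FK.InfiniteVolumeDLRExistence
import Summits.CriticalPhenomena.PercolationContinuityZ3.Theorems.FK.InfiniteVolumeDLRDomination
import HarnessLib

/-!
# FK-continuity transplant, FO-10 (infinite-volume structure): DLR random-cluster measures for every `q > 0` below the
# Bernoulli threshold `θ_bond(max(p, p/(p+q(1-p)))) = 0`

Registered R91 (cell INBOX l.6436, 2026-08-24); registry row FO-10b-g409s; label DLL-F (coordinator fk-4 g195).
Cell `fk-continuity` (bschramm), FO-10b lineage; `--supports stmt-CriticalPhenomena-4575`; builds on p205010 (kernel theorem,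
internal audit signed; external expert review pending). CONDITIONAL cell (FH AND TP_FK open at the same `p` for `q > 1`; K1);
UNCONDITIONAL structure here (every `d`, `0 ≤ p ≤ 1`, `q > 0`); no defs / sorries; NOT a discharge, NOT `_r4`; n_open = 2.

## What this file proves

* **`isDLRRandomCluster_of_localLimit_of_theta_eq_zero`** — a local limit of lattice-carried measures eventually having the
  one-edge conditional probabilities (4.38), with `max(p, p/(p+q(1-p))) ≤ c` and `θ_bond(c) = 0`, is a NON-PERCOLATING member
  of `R_{p,q}`: Theorem (4.31) (`InfiniteVolumeDLRLocalLimit.lean`) with its uniqueness hypothesis DISCHARGED by the domination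
  (`InfiniteVolumeDLRDomination.lean`) and the finite energy of the limit (`InfiniteVolumeDLRLocalLimitEnergy.lean`);
* **`exists_strictMono_tendsto_rcCondLaw_isDLRRandomCluster_of_theta_eq_zero`** — along ANY finite regions eventually containing
  every edge and ANY lattice boundary conditions, a subsequence of `φ^{ξ_n}_{Λ_n,p,q}` converges locally to a non-percolating
  member of `R_{p,q}` (compactness, `InfiniteVolumeDLRExistence.lean`);
* **`exists_isDLRRandomCluster_of_theta_eq_zero (hp : p ∈ Set.Icc 0 1) (hq : 0 < q) (c : unitInterval)
  (hpc : max p (p / (p + q * (1 - p))) ≤ c) (hθ : theta (zdGraph d) 0 c = 0) : ∃ P, IsDLRRandomCluster d p q P ∧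
  ∀ x, P (percolatesAt x) = 0`** — `R_{p,q} ≠ ∅` with a non-percolating member for EVERY `q > 0` below the Bernoulli
  threshold (`q < 1`: `θ(p/(p+q(1-p))) = 0`; `q ≥ 1`: `θ(p) = 0`), superseding the Peierls regime of
  `InfiniteVolumeDLRExistence.lean` (tree `theta_zd_eq_zero_of_lt_inv`). The tree had no member of `R_{p,q}` for `q < 1`.

## References

* G. Grimmett, *The Random-Cluster Model*, Springer 2006: §4.4 Thm. (4.31), (4.33)(b), (4.34)(a), p. 81. [Grimmett2006]
-/

noncomputable section

open MeasureTheory Set Filter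
open scoped Topology ENNReal

namespace Summit.CriticalPhenomena.PercolationContinuityZ3.Theorems.FK

open Literature.Probability.Percolation Literature.Probability.LatticeModels
open Literature.Probability.Percolation.DCT16 (exists_subset_box)

variable {d : ℕ}

/-! ### Existence of DLR measures below the Bernoulli threshold -/

section Subcritical

variable {p q : ℝ} {P : Measure (BondConfig (Site d))} {μ : ℕ → Measure (BondConfig (Site d))}

variable (d) in
/-- **Local limits of one-edge-DLR measures below the Bernoulli threshold are DLR random-cluster measures**
(`0 ≤ p ≤ 1`, `q > 0`, `max(p, p/(p+q(1-p))) ≤ c`, `θ_bond(c) = 0`): Theorem (4.31) with its uniqueness hypothesis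
DISCHARGED by the domination of the limit by `P_c`. [cite: Grimmett2006, Thm. (4.31), Thm. (4.33)(b), Thm. (3.21)] -/
theorem isDLRRandomCluster_of_localLimit_of_theta_eq_zero [IsProbabilityMeasure P] [∀ n, IsFiniteMeasure (μ n)]
    (hp : p ∈ Set.Icc (0 : ℝ) 1) (hq : 0 < q) (c : unitInterval) (hpc : max p (p / (p + q * (1 - p))) ≤ (c : ℝ))
    (hθ : theta (zdGraph d) 0 c = 0)
    (hlat : ∀ n, ∀ᵐ ω ∂(μ n), ω ⊆ (zdGraph d).edgeSet)
    (hconv : ∀ A : Set (BondConfig (Site d)), IsLocalEvent A → Tendsto (fun n => μ n A) atTop (𝓝 (P A)))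
    (hE : ∀ ⦃x y : Site d⦄, (zdGraph d).Adj x y → ∀ᶠ n in atTop, ∀ ⦃H₀ : Set (BondConfig (Site d))⦄,
      MeasurableSet H₀ →
      (μ n).real ({ω | s(x, y) ∈ ω} ∩ (fun η => η \ {s(x, y)}) ⁻¹' H₀) =
        p * (μ n).real ((fun η => η \ {s(x, y)}) ⁻¹' (H₀ ∩ openConn x y)) +
          p / (p + q * (1 - p)) * (μ n).real ((fun η => η \ {s(x, y)}) ⁻¹' (H₀ ∩ (openConn x y)ᶜ))) :
    IsDLRRandomCluster d p q P ∧ ∀ x : Site d, P (percolatesAt x) = 0 := by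
  have hc0 : 0 ≤ max p (p / (p + q * (1 - p))) := le_max_of_le_left hp.1
  have hperc : ∀ x : Site d, P (percolatesAt x) = 0 := fun x =>
    measure_percolatesAt_eq_zero_of_oneEdge_le_of_theta_eq_zero c hθ (ae_subset_edgeSet_of_localLimit hlat hconv)
      (fun a b hab H₀ hH₀ => (measureReal_setOf_mem_inter_preimage_le_of_forall_isLocalEvent hc0
        (fun B hB => measureReal_setOf_mem_inter_preimage_le_of_localLimit_of_isLocalEvent hconv (hE hab) hB) hH₀).trans
        (mul_le_mul_of_nonneg_right hpc measureReal_nonneg)) x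
  refine ⟨isDLRRandomCluster_of_localLimit d hp hq hlat hconv hE ?_, hperc⟩
  have h : ∀ᵐ ω ∂P, ∀ x : Site d, ω ∉ percolatesAt x := by
    rw [ae_all_iff]
    intro x
    rw [ae_iff]
    simpa only [not_not, Set.setOf_mem_eq] using hperc x
  filter_upwards [h] with ω hω
  have h0 : numInfiniteClusters ω = 0 := by
    by_contra hne
    obtain ⟨x, hx⟩ := (numInfiniteClusters_ne_zero_iff ω).1 hne
    exact hω x hx
  rw [h0]
  exact zero_le_one

variable (d) in
/-- **`R_{p,q} ≠ ∅` for every `q > 0` below the Bernoulli threshold**: if `0 ≤ p ≤ 1`, `q > 0` and Bernoulli bond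
percolation on `ℤ^d` with density `c ≥ max(p, p/(p+q(1-p)))` does not percolate (`θ(c) = 0`), then along ANY finite regions
`Λ_n` eventually containing every edge and ANY lattice boundary conditions `ξ_n` some subsequence of `φ^{ξ_n}_{Λ_n,p,q}`
converges on local events to a NON-PERCOLATING member of `R_{p,q}` — in particular for `q < 1` whenever
`p/(p+q(1-p)) < p_c(ℤ^d)`, and for `q ≥ 1` whenever `p < p_c(ℤ^d)`. [cite: Grimmett2006, Thm. (4.31), (4.33), (4.34)(a), p. 81] -/
theorem exists_strictMono_tendsto_rcCondLaw_isDLRRandomCluster_of_theta_eq_zero (hp : p ∈ Set.Icc (0 : ℝ) 1)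
    (hq : 0 < q) (c : unitInterval) (hpc : max p (p / (p + q * (1 - p))) ≤ (c : ℝ)) (hθ : theta (zdGraph d) 0 c = 0)
    {Λ : ℕ → Finset (Site d)} {ξ : ℕ → BondConfig (Site d)} (hξ : ∀ n, ξ n ⊆ (zdGraph d).edgeSet)
    (hΛ : ∀ ⦃x y : Site d⦄, (zdGraph d).Adj x y → ∀ᶠ n in atTop, s(x, y) ∈ edgesIn (zdGraph d) (Λ n)) :
    ∃ φ : ℕ → ℕ, StrictMono φ ∧ ∃ P : Measure (BondConfig (Site d)), IsProbabilityMeasure P ∧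
      (∀ S : Set (BondConfig (Site d)), IsLocalEvent S →
        Tendsto (fun n => rcCondLaw p q (Λ (φ n)) (ξ (φ n)) S) atTop (𝓝 (P S))) ∧
      IsDLRRandomCluster d p q P ∧ ∀ x : Site d, P (percolatesAt x) = 0 := by
  have hprob : ∀ n, IsProbabilityMeasure (rcCondLaw p q (Λ n) (ξ n)) := fun n =>
    isProbabilityMeasure_rcCondLaw hp hq (Λ n) (ξ n)
  obtain ⟨φ, hφ, P, hP, hconv⟩ := exists_strictMono_localLimit (fun n => rcCondLaw p q (Λ n) (ξ n)) hprob
  haveI := hP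
  haveI : ∀ n, IsFiniteMeasure (rcCondLaw p q (Λ (φ n)) (ξ (φ n))) := fun n => by
    haveI := hprob (φ n)
    infer_instance
  have hres := isDLRRandomCluster_of_localLimit_of_theta_eq_zero d (μ := fun n => rcCondLaw p q (Λ (φ n)) (ξ (φ n)))
    hp hq c hpc hθ (fun n => rcCondLaw_ae_subset_edgeSet hp hq _ (hξ _)) hconv
    (fun x y hxy => (hφ.tendsto_atTop.eventually (hΛ hxy)).mono fun n hn H₀ hH₀ =>
      rcCondLaw_real_edgeOpen_inter_preimage_eq hp hq _ _ hn hH₀)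
  exact ⟨φ, hφ, P, hP, hconv, hres.1, hres.2⟩

variable (d) in
/-- **`R_{p,q} ≠ ∅` below the Bernoulli threshold, every `q > 0`** (free boundary conditions on the boxes `Λ_n`):
`θ_bond(c) = 0` for some `c ≥ max(p, p/(p+q(1-p)))` gives a non-percolating DLR random-cluster measure with parameters
`p, q` on `ℤ^d`. [cite: Grimmett2006, Thm. (4.31), (4.33), (4.34)(a), p. 81] -/
theorem exists_isDLRRandomCluster_of_theta_eq_zero (hp : p ∈ Set.Icc (0 : ℝ) 1) (hq : 0 < q) (c : unitInterval)
    (hpc : max p (p / (p + q * (1 - p))) ≤ (c : ℝ)) (hθ : theta (zdGraph d) 0 c = 0) :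
    ∃ P : Measure (BondConfig (Site d)), IsDLRRandomCluster d p q P ∧ ∀ x : Site d, P (percolatesAt x) = 0 := by
  have hΛ : ∀ ⦃x y : Site d⦄, (zdGraph d).Adj x y → ∀ᶠ n in atTop, s(x, y) ∈ edgesIn (zdGraph d) (box d n) := by
    intro x y hxy
    obtain ⟨n₀, hn₀⟩ := exists_subset_box ({x, y} : Finset (Site d))
    refine eventually_atTop.2 ⟨n₀, fun n hn => ?_⟩
    rw [mem_edgesIn_iff]
    refine ⟨(SimpleGraph.mem_edgeSet _).2 hxy, fun z hz => ?_⟩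
    rcases Sym2.mem_iff.1 hz with rfl | rfl
    · exact box_mono d hn (hn₀ (Finset.mem_insert_self _ _))
    · exact box_mono d hn (hn₀ (Finset.mem_insert_of_mem (Finset.mem_singleton_self _)))
  obtain ⟨φ, -, P, -, -, hDLR, hperc⟩ := exists_strictMono_tendsto_rcCondLaw_isDLRRandomCluster_of_theta_eq_zero d
    hp hq c hpc hθ (Λ := fun n => box d n) (ξ := fun _ => ∅) (fun _ => Set.empty_subset _) hΛ
  exact ⟨P, hDLR, hperc⟩

end Subcritical

end Summit.CriticalPhenomena.PercolationContinuityZ3.Theorems.FK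

end
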